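import Summits.QuantumFields.YangMills.Theorems.BalabanUVNodesN07ConstraintLogBridgePr
import Summits.QuantumFields.YangMills.Theorems.BalabanUVNodesN07SectCRegimeOfRecordSmall
import HarnessLib

/-!
# N07 — SECT. C's REGIME AND (48) IN THE SMALL AT def-Y's FRAMED LETTERS, FOR EVERY FRAME DATUM (`…Pr` re-press of ✓`…N07SectCRegimeOfRecordSmall` §2–§3 + ✓p828374 §2 behind (A2)+(A3)):
# `Prop4Hyp (C^{sl,pr}) C₂ c₄` and `Regime (H₁^{pr}) 0 (C^{sl,pr}) ‖H₁^{pr}‖ 0 C₂ c₄ 0 a_C ε_C` for all `0 < a_C ≤ ε_C ≤ t₀` at a guarded background — the framed first-order token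
# `DC^{sl,pr}(0) = 0` being a THEOREM for every datum (def-Y's kernel guard ✓`hasFDerivAt_CslprOfRecord_zero_iff` + ✓`c1Tok_of_smallBelow`) — hence (48)^{pr} for all small `A′`

Cell `pub-ymgap`, width seat `pub-ymgap-dag-n07-w3` (g28), INTENT-9 ∕ CLAIM-9 (№608 (B) re-press share, n07 lane).  `--kind proof --supports stmt-QuantumFields-27238 --as helper`; count-neutral.
[15] = [Balaban1985Variational].

WHAT (kernel, sorry-free, standard axioms; any `N`, any guarded background `U₀`, ANY `𝔥 : FrameDatum (F.P K) N k U₀`; EXISTENTIAL, NON-UNIFORM constants).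
* §0 (abstract) ★ `exists_regime_of_prop4Hyp` — for any CLM `H` and any `C` with `Prop4Hyp C C₂ c₄` (`C₂ ≥ 0`, `c₄ > 0`): `∃ t₀ > 0, ∀ 0 < a_C ≤ ε_C ≤ t₀, Regime H 0 C ‖H‖ 0 C₂ c₄ 0 a_C ε_C`
  (the arithmetic of ✓`exists_sectCRegime_ofRecord` once, over abstract carriers: `4ε_C ≤ c₄`, `8‖H‖C₂ε_C < 1`).
* §1 `CslprOfRecord_zero`, `analyticAt_CslprOfRecord_zero`; `DC^{sl,pr}(0) = 0` for EVERY datum is used inline (def-Y's ✓`hasFDerivAt_CslprOfRecord_zero_iff` + this lineage's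
  ✓`c1Tok_of_smallBelow`; as a named letter it is ★ PT-B's ✓`C44IterMh.hasFDerivAt_CslprOfRecord_zero`, not restated).
* §2 ★★ `exists_prop4Hyp_cslprOfRecord` — `∃ C₂ ≥ 0, c₄ > 0, Prop4Hyp (CslprOfRecord … 𝔥 levB) C₂ c₄` (analytic at `0`, vanishing to second order; ✓`exists_sq_bound_of_contDiffAt_two`).
* §3 ★★★ `exists_sectCRegimePr_ofRecord` — the framed Sect. C regime for all small radii (the frame-free ✓`exists_sectCRegime_ofRecord` verbatim at `(H1prOfRecordAtBg … 𝔥 …, CslprOfRecord … 𝔥 …)`).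
* §4 ★★★ `exists_eq48Pr_ofRecord_small` — (48)^{pr} for every small `A′`: `∃ t₀ > 0, ∀ 0 < a_C ≤ ε_C ≤ t₀, ∀ ‖A′‖ < a_C, Q^{pr}(T47 A′) + C^{sl,pr}(T47 A′) = Q^{pr} A′` (✓`readFun_Qpr_T47_add_cslPr`).

HONEST LABELS.  Existential non-uniform constants (per lattice, background, datum — NOT print's `O(1)` Prop. 3); `hpos`∕`hQ` of the framed triple stay binders (their discharge at `U₀ = 1` is (A1)'s (P3) +
✓`…N07QprOfRecordOnto`); over the frameless datum each statement IS its frame-free companion; nothing of Bałaban's estimates; count-neutral; K0ᴬ ⟨27238⟩ NOT closed; N07 NOT discharged; R4 is the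
conditional finite-𝕋⁴ rung `BalabanLadder.UV` only; finite torus, fixed `ε` — nothing continuum ∕ OS ∕ Clay.  **The Yang–Mills mass gap is NOT proved by any of this.**  No `sorry`, no `def`, no
`instance ∕ notation`; standard axioms.
-/

set_option autoImplicit false

noncomputable section

open Set Metric Filter Topology
open scoped Matrix Matrix.Norms.L2Operator InnerProductSpace

namespace Summit.QuantumFields.YangMills.Theorems.N07SectCRegimePrOfRecordSmall

open Literature.MathematicalPhysics.QuantumFieldTheory.Balaban1983to89
open Literature.MathematicalPhysics.QuantumFieldTheory.Balaban1983to89.T4Continuum (T4Family)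
open Literature.MathematicalPhysics.QuantumFieldTheory.Balaban1983to89.Node00
open B11Eq103H1Complex (SiteL2K BondL2K readFun)
open B11Eq111FrakG (nabla115)
open B11Eq115Space (NegSize NegSup JetSup)
open B11Eq174Chart (Regime)
open B11Prop6Scheme (Prop4Hyp)
open B11Eq90V0GroupComposed (T47)
open Summit.QuantumFields.YangMills.Theorems.N07SchemeTokensOfRecord (c1Tok_of_smallBelow)
open Summit.QuantumFields.YangMills.Theorems.N07SectCRegimeOfRecordSmall (exists_sq_bound_of_contDiffAt_two)
open Summit.QuantumFields.YangMills.Theorems.N07ConstraintLogBridgePr (readFun_Qpr_T47_add_cslPr)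

/-! ## §0  The Sect. C regime arithmetic over abstract carriers -/

section Abstract

variable {𝒴 𝒵 : Type*} [NormedAddCommGroup 𝒴] [NormedSpace ℂ 𝒴] [NormedAddCommGroup 𝒵] [NormedSpace ℂ 𝒵]

/-- ★ **A SECT. C REGIME FOR ALL SMALL RADII FROM `Prop4Hyp` ALONE**: for any CLM `H : 𝒵 →L 𝒴` and any `C : 𝒴 → 𝒵` with `Prop4Hyp C C₂ c₄` (`C₂ ≥ 0`, `c₄ > 0`) there is `t₀ > 0` such that for all
`0 < a_C ≤ ε_C ≤ t₀`: `Regime H 0 C ‖H‖ 0 C₂ c₄ 0 a_C ε_C` ((52)–(54)∕(118)–(121) hold once `4ε_C ≤ c₄` and `8‖H‖C₂ε_C < 1`). [cite: Balaban1985Variational, (51)–(54) p.285, Prop. 3 p.289, (117)–(121) p.295] -/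
theorem exists_regime_of_prop4Hyp (H : 𝒵 →L[ℂ] 𝒴) (C : 𝒴 → 𝒵) {C₂ c₄ : ℝ} (hC₂ : 0 ≤ C₂) (hc₄ : 0 < c₄) (hP : Prop4Hyp C C₂ c₄) :
    ∃ t₀ > 0, ∀ εC aC : ℝ, 0 < aC → aC ≤ εC → εC ≤ t₀ → Regime H 0 C ‖H‖ 0 C₂ c₄ 0 aC εC := by
  set b : ℝ := ‖H‖ with hb
  have hb0 : 0 ≤ b := norm_nonneg H
  have hbC : 0 ≤ b * C₂ := mul_nonneg hb0 hC₂
  set t₀ : ℝ := min (c₄ / 4) (1 / (8 * (b * C₂) + 1)) with ht₀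
  have hden : 0 < 8 * (b * C₂) + 1 := by positivity
  have ht₀pos : 0 < t₀ := lt_min (by positivity) (by positivity)
  refine ⟨t₀, ht₀pos, fun εC aC haC hle hε => ?_⟩
  have hεpos : 0 < εC := haC.trans_le hle
  have hsum : εC + aC ≤ 2 * εC := by linarith
  have h4 : 4 * εC ≤ c₄ := by
    have := hε.trans (min_le_left _ _)
    linarith
  have h8 : 8 * (b * C₂) * εC < 1 := by
    have h1 : εC ≤ 1 / (8 * (b * C₂) + 1) := hε.trans (min_le_right _ _)
    have h2 : 8 * (b * C₂) * εC ≤ 8 * (b * C₂) * (1 / (8 * (b * C₂) + 1)) := mul_le_mul_of_nonneg_left h1 (by positivity)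
    have h3 : 8 * (b * C₂) * (1 / (8 * (b * C₂) + 1)) < 1 := by
      rw [mul_one_div, div_lt_one hden]
      linarith
    exact h2.trans_lt h3
  refine
    { norm_G := fun f => H.le_opNorm f
      norm_L := fun Y => by simp
      quad := hP.quadAnalytic
      B₀_nonneg := hb0
      C₄_nonneg := hC₂
      θ_nonneg := le_rfl
      ε₄_nonneg := hεpos.le
      dom := by linarith
      self := ?_
      contr := ?_ }
  · have hsq : (εC + aC) ^ 2 ≤ (2 * εC) ^ 2 := by
      have h1 : 0 ≤ εC + aC := by linarith
      nlinarith
    have h1 : b * C₂ * (εC + aC) ^ 2 ≤ b * C₂ * (2 * εC) ^ 2 := mul_le_mul_of_nonneg_left hsq hbC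
    have h2 : b * C₂ * (2 * εC) ^ 2 = (4 * (b * C₂) * εC) * εC := by ring
    have h3 : 4 * (b * C₂) * εC ≤ 1 := by nlinarith
    have h4' : (4 * (b * C₂) * εC) * εC ≤ 1 * εC := mul_le_mul_of_nonneg_right h3 hεpos.le
    nlinarith
  · have h1 : 4 * b * C₂ * (εC + aC) ≤ 4 * b * C₂ * (2 * εC) := by
      have : 0 ≤ 4 * b * C₂ := by positivity
      exact mul_le_mul_of_nonneg_left hsum this
    nlinarith

end Abstract

/-! ## §1–§3  The framed letters at a guarded background -/

section Record

variable (F : T4Family) (N : ℕ) [NeZero N] (K : ℕ) (k : ℕ) (Ω : ℕ → Set (Site (F.P K) 0)) (U₀ : GaugeField (F.P K) 0 (SU N))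
  [Fact (0 < (F.L : ℝ))] [Fact (0 < (F.P K).eta k)] [Fact (0 < c0Rec F K k)] [Fact (∀ c, 0 < wBRec F K k c)]
  (𝔥 : FrameDatum (F.P K) N k U₀) (levB : PBond (F.P K) k → ℕ)

omit [Fact (0 < c0Rec F K k)] [Fact (∀ c, 0 < wBRec F K k c)] in
/-- `C^{sl,pr}(0) = 0` under the guard (✓`CprOfRecord_zero` + linearity of the traceless projection). [cite: Balaban1985Variational, (44) p.285] -/
theorem CslprOfRecord_zero (hU₀ : SmallBelow (avOfRecord F N K) k U₀) : CslprOfRecord F N K k Ω U₀ 𝔥 levB 0 = 0 := by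
  rw [CslprOfRecord_apply, map_zero, CprOfRecord_zero F N K k Ω U₀ 𝔥 levB hU₀]

omit [Fact (0 < c0Rec F K k)] [Fact (∀ c, 0 < wBRec F K k c)] in
/-- `C^{sl,pr}` is ℂ-analytic at `0` under the guard (✓`analyticAt_CprOfRecord_zero` composed with the CLM `P = slProjLit`). [cite: Balaban1985Variational, p.290 («It is analytic in A′ …»), (44) p.285] -/
theorem analyticAt_CslprOfRecord_zero (hU₀ : SmallBelow (avOfRecord F N K) k U₀) : AnalyticAt ℂ (CslprOfRecord F N K k Ω U₀ 𝔥 levB) 0 :=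
  (analyticAt_CprOfRecord_zero F N K k Ω U₀ 𝔥 levB hU₀).comp_of_eq ((slProjLit F N K k Ω U₀).analyticAt 0) (map_zero _)

omit [Fact (0 < c0Rec F K k)] [Fact (∀ c, 0 < wBRec F K k c)] in
/-- ★★ **`Prop4Hyp C^{sl,pr} C₂ c₄` FOR SOME `C₂ ≥ 0`, `c₄ > 0`**, for every frame datum at a guarded background (analytic at `0`, `C^{sl,pr}(0) = 0`, `DC^{sl,pr}(0) = 0` ⟹ a quadratic bound on a
ball, ✓`exists_sq_bound_of_contDiffAt_two`). [cite: Balaban1985Variational, (44) p.285, Prop. 4 p.292, (56) p.286] -/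
theorem exists_prop4Hyp_cslprOfRecord (hU₀ : SmallBelow (avOfRecord F N K) k U₀) :
    ∃ C₂ c₄ : ℝ, 0 ≤ C₂ ∧ 0 < c₄ ∧ Prop4Hyp (CslprOfRecord F N K k Ω U₀ 𝔥 levB) C₂ c₄ := by
  have han : AnalyticAt ℂ (CslprOfRecord F N K k Ω U₀ 𝔥 levB) 0 := analyticAt_CslprOfRecord_zero F N K k Ω U₀ 𝔥 levB hU₀
  have hanR : ContDiffAt ℝ 2 (CslprOfRecord F N K k Ω U₀ 𝔥 levB) 0 := han.contDiffAt.restrict_scalars ℝ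
  have h0 : CslprOfRecord F N K k Ω U₀ 𝔥 levB 0 = 0 := CslprOfRecord_zero F N K k Ω U₀ 𝔥 levB hU₀
  have hD0 : fderiv ℝ (CslprOfRecord F N K k Ω U₀ 𝔥 levB) 0 = 0 := by
    -- `DC^{sl,pr}(0) = 0` for EVERY datum: def-Y's kernel guard ✓`hasFDerivAt_CslprOfRecord_zero_iff` + this lineage's ✓`c1Tok_of_smallBelow`
    -- (the named framed letter is ★ PT-B's ✓`C44IterMh.hasFDerivAt_CslprOfRecord_zero`; re-derived inline to keep the import cone small)
    rw [(((hasFDerivAt_CslprOfRecord_zero_iff F N K k Ω U₀ 𝔥 levB hU₀).2 (c1Tok_of_smallBelow F N K k Ω U₀ levB hU₀)).restrictScalars ℝ).fderiv,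
      ContinuousLinearMap.restrictScalars_zero]
  obtain ⟨C, r, hC, hr, hq⟩ := exists_sq_bound_of_contDiffAt_two hanR h0 hD0
  obtain ⟨r', hr', hd⟩ := Metric.eventually_nhds_iff.1 han.eventually_analyticAt
  refine ⟨C, min r r', hC, lt_min hr hr', ⟨fun Y hY => hq Y (hY.trans_le (min_le_left _ _)), fun Y hY => ?_⟩⟩
  have hY' : dist Y 0 < r' := by rw [dist_zero_right]; exact (show ‖Y‖ < min r r' from hY).trans_le (min_le_right _ _)
  exact (hd hY').differentiableAt.differentiableWithinAt

variable (a : ℝ)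
  (hpos : ∀ x, x ≠ 0 → 0 < RCLike.re ⟪x, laplaceAOfRecord F N k U₀ (QprOfRecord F N k U₀ 𝔥) (QprimeOfRecord F N k U₀) a x⟫_ℂ)
  (hQ : Function.Surjective (QprOfRecord F N k U₀ 𝔥))

/-- ★★★ **SECT. C's REGIME AT THE FRAMED LETTERS FOR ALL SMALL RADII**: at a guarded background there are `C₂ ≥ 0`, `c₄, t₀ > 0` with `Prop4Hyp C^{sl,pr} C₂ c₄` and, for every
`0 < a_C ≤ ε_C ≤ t₀`, `Regime (H₁^{pr}) 0 (C^{sl,pr}) ‖H₁^{pr}‖ 0 C₂ c₄ 0 a_C ε_C`.  EXISTENTIAL, NON-UNIFORM constants. [cite: Balaban1985Variational, (51)–(54) p.285, Prop. 3 p.289, Prop. 4 p.292, (117)–(121) p.295] -/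
theorem exists_sectCRegimePr_ofRecord (hU₀ : SmallBelow (avOfRecord F N K) k U₀) :
    ∃ C₂ c₄ t₀ : ℝ, 0 ≤ C₂ ∧ 0 < c₄ ∧ 0 < t₀ ∧ Prop4Hyp (CslprOfRecord F N K k Ω U₀ 𝔥 levB) C₂ c₄ ∧
      ∀ εC aC : ℝ, 0 < aC → aC ≤ εC → εC ≤ t₀ →
        Regime (H1prOfRecordAtBg F N K k Ω U₀ 𝔥 levB a hpos hQ) 0 (CslprOfRecord F N K k Ω U₀ 𝔥 levB)
          ‖H1prOfRecordAtBg F N K k Ω U₀ 𝔥 levB a hpos hQ‖ 0 C₂ c₄ 0 aC εC := by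
  obtain ⟨C₂, c₄, hC₂, hc₄, hP⟩ := exists_prop4Hyp_cslprOfRecord F N K k Ω U₀ 𝔥 levB hU₀
  obtain ⟨t₀, ht₀, hR⟩ := exists_regime_of_prop4Hyp (H1prOfRecordAtBg F N K k Ω U₀ 𝔥 levB a hpos hQ) (CslprOfRecord F N K k Ω U₀ 𝔥 levB) hC₂ hc₄ hP
  exact ⟨C₂, c₄, t₀, hC₂, hc₄, ht₀, hP, hR⟩

/-! ## §4  (48)^{pr} for every small `A′` -/

/-- ★★★ **(48) AT THE FRAMED LETTERS FOR EVERY SMALL `A′`, IN THE SMALL**: at a guarded background there is `t₀ > 0` such that for all `0 < a_C ≤ ε_C ≤ t₀` and all `‖A′‖ < a_C`,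
`Q^{pr}(T47_{ε_C} A′) + C^{sl,pr}(T47_{ε_C} A′) = Q^{pr} A′` (read on the functions) — ✓`readFun_Qpr_T47_add_cslPr` under §3's regime.
[cite: Balaban1985Variational, (48) p.285, Prop. 3 p.289, (51)–(54) p.285; Balaban1985BackgroundPropagators, (3.113) p.418] -/
theorem exists_eq48Pr_ofRecord_small (hU₀ : SmallBelow (avOfRecord F N K) k U₀) :
    ∃ t₀ > 0, ∀ εC aC : ℝ, 0 < aC → aC ≤ εC → εC ≤ t₀ → ∀ A' : Space115Lit F N K k Ω U₀, ‖A'‖ < aC →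
      readFun (phiRec N) _ (wBRec F K k) (QprOfRecord F N k U₀ 𝔥)
          (JetSup.equiv _ _ (nabla115 ((F.P K).eta k) (unitsOfRecord F N U₀))
            (T47 (H1prOfRecordAtBg F N K k Ω U₀ 𝔥 levB a hpos hQ) (CslprOfRecord F N K k Ω U₀ 𝔥 levB) εC A')) +
        NegSup.equiv _ _ (CslprOfRecord F N K k Ω U₀ 𝔥 levB
          (T47 (H1prOfRecordAtBg F N K k Ω U₀ 𝔥 levB a hpos hQ) (CslprOfRecord F N K k Ω U₀ 𝔥 levB) εC A')) =
      readFun (phiRec N) _ (wBRec F K k) (QprOfRecord F N k U₀ 𝔥) (JetSup.equiv _ _ (nabla115 ((F.P K).eta k) (unitsOfRecord F N U₀)) A') := by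
  obtain ⟨C₂, c₄, t₀, -, -, ht₀, -, hReg⟩ := exists_sectCRegimePr_ofRecord F N K k Ω U₀ 𝔥 levB a hpos hQ hU₀
  exact ⟨t₀, ht₀, fun εC aC haC hle hε A' hA' => readFun_Qpr_T47_add_cslPr F N K k Ω U₀ 𝔥 levB a hpos hQ (hReg εC aC haC hle hε) hA'⟩

end Record

end Summit.QuantumFields.YangMills.Theorems.N07SectCRegimePrOfRecordSmall

end
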